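import Summits.QuantumFields.YangMills.Theorems.ColdStartUniversalityUniformColdStartMixingLogSobolevIffEntropyDecay
import Summits.QuantumFields.YangMills.Theorems.ColdStartUniversalityUniformColdStartMixingOfLogSobolevStub
import HarnessLib

/-!
# Route `ColdStartUniversality`, crux K_A1 `UniformColdStartMixing` (stmt-QuantumFields-24809, aside), LINE 4 «cold_entropy»:
# the registered stub `stub_entropyDissipation` and the crux BY NAME from K-UNIFORM EXPONENTIAL ENTROPY DECAY (UED)

Two-line sequel (seat `ym-line-csu-p1`, g22; `--supports stmt-QuantumFields-24809`) of g21's `stub_entropyDissipation_of_uniformLogSobolev`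
((ULS) ⇒ stub) and g22's `uniformLogSobolev_iff_uniformEntropyDecay` ((ULS) ⟺ (UED)):
* ★★ `stub_entropyDissipation_of_uniformEntropyDecay : (UED) → __Registered.stub_entropyDissipation`;
* ★★ `UniformColdStartMixing_of_uniformEntropyDecay_of_budget : (UED) → stub_coldEntropyBudget → UniformColdStartMixing`,
where (UED) = «∃γ₁ ∀F γ (0<γ≤γ₁) ∃c>0 ∃K₀ ∀K≥K₀, along EVERY Markov kernel family realising the SZZ transition laws at cut-off K, every
positive C³ compactly supported cylinder density Q and every lattice time t: Ent_{μ_K}(κ_t Q) ≤ exp(−4c·ε_K t)·Ent_{μ_K}(Q)» (rate 4c per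
unit PHYSICAL time, uniformly in K).  So LINE 4 may equivalently START from a K-uniform dynamical statement about smooth densities.
HONEST FRAMING: (UED) ⟺ (ULS) and `stub_coldEntropyBudget` are K-UNIFORM and OPEN; item 24809 is ASIDE and is not restated; nothing
K-uniform is proved; no crux, rung or summit statement is proved; the Yang–Mills mass gap is NOT proved.
-/

set_option autoImplicit false

noncomputable section

namespace Summit.QuantumFields.YangMills.Theorems.ColdStartUniversality

open MeasureTheory ProbabilityTheory
open scoped BigOperators NNReal ENNReal
open Literature.Probability.Process Literature.MathematicalPhysics.QuantumFieldTheory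
open Literature.MathematicalPhysics.QuantumLattice (fundamentalRep fundamentalLatticeRep continuous_fundamentalRep)
open Literature.MathematicalPhysics.QuantumFieldTheory.Balaban1983to89

/-- ★★ **`stub_entropyDissipation` ⇐ (UED)** (K-uniform exponential entropy decay in physical time of positive smooth cylinder densities
along every realising kernel family), via (UED) ⇒ (ULS) (`uniformLogSobolev_iff_uniformEntropyDecay`) and g21's
`stub_entropyDissipation_of_uniformLogSobolev`. [cite: BakryGentilLedoux2014, Thm 5.2.1] -/
theorem stub_entropyDissipation_of_uniformEntropyDecay
    (hUED : (∃ γ₁ : ℝ, 0 < γ₁ ∧ ∀ (F : T3ContinuumYM3Torus.T3Family) (γ : ℝ), 0 < γ → γ ≤ γ₁ →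
      ∃ c : ℝ, 0 < c ∧ ∃ K₀ : ℕ, ∀ K : ℕ, K₀ ≤ K →
      ∀ (κ : ℝ≥0 → Kernel (GaugeConfig 3 ((F.P K).sitesPerDir 0) (Matrix.specialUnitaryGroup (Fin 2) ℂ))
          (GaugeConfig 3 ((F.P K).sitesPerDir 0) (Matrix.specialUnitaryGroup (Fin 2) ℂ))) (_ : ∀ t, IsMarkovKernel (κ t)),
        (∀ (t : ℝ≥0) (x : GaugeConfig 3 ((F.P K).sitesPerDir 0) (Matrix.specialUnitaryGroup (Fin 2) ℂ))
          (Ω : Type) [MeasurableSpace Ω] (P : Measure Ω) [IsProbabilityMeasure P]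
          (W : ℝ≥0 → Ω → (Edge 3 ((F.P K).sitesPerDir 0) × NoiseIdx 2 → ℝ)) (hW : IsFlatBrownian W P)
          (U : ℝ≥0 → Ω → GaugeConfig 3 ((F.P K).sitesPerDir 0) (Matrix.specialUnitaryGroup (Fin 2) ℂ)),
          (∀ ω, U 0 ω = x) →
          (latticeLangevinDynamics (fundamentalLatticeRep 2) ((γ * (F.P K).eps)⁻¹ / 2)).IsSolution (fundamentalRep (Fin 2))
            hW.natFiltration P W U →
          κ t x = P.map (U t)) →
        ∀ (q : (Edge 3 ((F.P K).sitesPerDir 0) × Fin 2 × Fin 2 × Bool → ℝ) → ℝ), ContDiff ℝ 3 q → HasCompactSupport q →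
        (∀ x : GaugeConfig 3 ((F.P K).sitesPerDir 0) (Matrix.specialUnitaryGroup (Fin 2) ℂ),
          0 < q (fun p => (fun z : ℂ => if p.2.2.2 then z.im else z.re)
            ((fundamentalRep (Fin 2) (x p.1) : Matrix (Fin 2) (Fin 2) ℂ) p.2.1 p.2.2.1))) →
        ∀ t : ℝ≥0,
        let Q : GaugeConfig 3 ((F.P K).sitesPerDir 0) (Matrix.specialUnitaryGroup (Fin 2) ℂ) → ℝ := fun x =>
          q (fun p => (fun z : ℂ => if p.2.2.2 then z.im else z.re)
            ((fundamentalRep (Fin 2) (x p.1) : Matrix (Fin 2) (Fin 2) ℂ) p.2.1 p.2.2.1))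
        (∫ x, (∫ y, Q y ∂(κ t x)) * Real.log (∫ y, Q y ∂(κ t x))
            ∂(wilsonMeasure (d := 3) (L := (F.P K).sitesPerDir 0) (fundamentalRep (Fin 2)) ((γ * (F.P K).eps)⁻¹ / 2))) -
            (∫ x, (∫ y, Q y ∂(κ t x))
              ∂(wilsonMeasure (d := 3) (L := (F.P K).sitesPerDir 0) (fundamentalRep (Fin 2)) ((γ * (F.P K).eps)⁻¹ / 2))) *
              Real.log (∫ x, (∫ y, Q y ∂(κ t x))
                ∂(wilsonMeasure (d := 3) (L := (F.P K).sitesPerDir 0) (fundamentalRep (Fin 2)) ((γ * (F.P K).eps)⁻¹ / 2))) ≤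
          Real.exp (-4 * (c * (F.P K).eps) * t) *
            ((∫ x, Q x * Real.log (Q x)
                ∂(wilsonMeasure (d := 3) (L := (F.P K).sitesPerDir 0) (fundamentalRep (Fin 2)) ((γ * (F.P K).eps)⁻¹ / 2))) -
              (∫ x, Q x ∂(wilsonMeasure (d := 3) (L := (F.P K).sitesPerDir 0) (fundamentalRep (Fin 2)) ((γ * (F.P K).eps)⁻¹ / 2))) *
                Real.log (∫ x, Q x
                  ∂(wilsonMeasure (d := 3) (L := (F.P K).sitesPerDir 0) (fundamentalRep (Fin 2)) ((γ * (F.P K).eps)⁻¹ / 2)))))) :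
    Summit.QuantumFields.YangMills.Cruxes.UniformColdStartMixing.ColdEntropy.__Registered.stub_entropyDissipation :=
  stub_entropyDissipation_of_uniformLogSobolev (uniformLogSobolev_iff_uniformEntropyDecay.2 hUED)

/-- ★★ **THE CRUX `UniformColdStartMixing` from (UED) + the K-uniform entropy budget `stub_coldEntropyBudget`** (the skeleton's
composition; both hypotheses K-UNIFORM and OPEN). [cite: BakryGentilLedoux2014, Thm 5.2.1] -/
theorem UniformColdStartMixing_of_uniformEntropyDecay_of_budget
    (hUED : (∃ γ₁ : ℝ, 0 < γ₁ ∧ ∀ (F : T3ContinuumYM3Torus.T3Family) (γ : ℝ), 0 < γ → γ ≤ γ₁ →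
      ∃ c : ℝ, 0 < c ∧ ∃ K₀ : ℕ, ∀ K : ℕ, K₀ ≤ K →
      ∀ (κ : ℝ≥0 → Kernel (GaugeConfig 3 ((F.P K).sitesPerDir 0) (Matrix.specialUnitaryGroup (Fin 2) ℂ))
          (GaugeConfig 3 ((F.P K).sitesPerDir 0) (Matrix.specialUnitaryGroup (Fin 2) ℂ))) (_ : ∀ t, IsMarkovKernel (κ t)),
        (∀ (t : ℝ≥0) (x : GaugeConfig 3 ((F.P K).sitesPerDir 0) (Matrix.specialUnitaryGroup (Fin 2) ℂ))
          (Ω : Type) [MeasurableSpace Ω] (P : Measure Ω) [IsProbabilityMeasure P]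
          (W : ℝ≥0 → Ω → (Edge 3 ((F.P K).sitesPerDir 0) × NoiseIdx 2 → ℝ)) (hW : IsFlatBrownian W P)
          (U : ℝ≥0 → Ω → GaugeConfig 3 ((F.P K).sitesPerDir 0) (Matrix.specialUnitaryGroup (Fin 2) ℂ)),
          (∀ ω, U 0 ω = x) →
          (latticeLangevinDynamics (fundamentalLatticeRep 2) ((γ * (F.P K).eps)⁻¹ / 2)).IsSolution (fundamentalRep (Fin 2))
            hW.natFiltration P W U →
          κ t x = P.map (U t)) →
        ∀ (q : (Edge 3 ((F.P K).sitesPerDir 0) × Fin 2 × Fin 2 × Bool → ℝ) → ℝ), ContDiff ℝ 3 q → HasCompactSupport q →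
        (∀ x : GaugeConfig 3 ((F.P K).sitesPerDir 0) (Matrix.specialUnitaryGroup (Fin 2) ℂ),
          0 < q (fun p => (fun z : ℂ => if p.2.2.2 then z.im else z.re)
            ((fundamentalRep (Fin 2) (x p.1) : Matrix (Fin 2) (Fin 2) ℂ) p.2.1 p.2.2.1))) →
        ∀ t : ℝ≥0,
        let Q : GaugeConfig 3 ((F.P K).sitesPerDir 0) (Matrix.specialUnitaryGroup (Fin 2) ℂ) → ℝ := fun x =>
          q (fun p => (fun z : ℂ => if p.2.2.2 then z.im else z.re)
            ((fundamentalRep (Fin 2) (x p.1) : Matrix (Fin 2) (Fin 2) ℂ) p.2.1 p.2.2.1))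
        (∫ x, (∫ y, Q y ∂(κ t x)) * Real.log (∫ y, Q y ∂(κ t x))
            ∂(wilsonMeasure (d := 3) (L := (F.P K).sitesPerDir 0) (fundamentalRep (Fin 2)) ((γ * (F.P K).eps)⁻¹ / 2))) -
            (∫ x, (∫ y, Q y ∂(κ t x))
              ∂(wilsonMeasure (d := 3) (L := (F.P K).sitesPerDir 0) (fundamentalRep (Fin 2)) ((γ * (F.P K).eps)⁻¹ / 2))) *
              Real.log (∫ x, (∫ y, Q y ∂(κ t x))
                ∂(wilsonMeasure (d := 3) (L := (F.P K).sitesPerDir 0) (fundamentalRep (Fin 2)) ((γ * (F.P K).eps)⁻¹ / 2))) ≤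
          Real.exp (-4 * (c * (F.P K).eps) * t) *
            ((∫ x, Q x * Real.log (Q x)
                ∂(wilsonMeasure (d := 3) (L := (F.P K).sitesPerDir 0) (fundamentalRep (Fin 2)) ((γ * (F.P K).eps)⁻¹ / 2))) -
              (∫ x, Q x ∂(wilsonMeasure (d := 3) (L := (F.P K).sitesPerDir 0) (fundamentalRep (Fin 2)) ((γ * (F.P K).eps)⁻¹ / 2))) *
                Real.log (∫ x, Q x
                  ∂(wilsonMeasure (d := 3) (L := (F.P K).sitesPerDir 0) (fundamentalRep (Fin 2)) ((γ * (F.P K).eps)⁻¹ / 2))))))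
    (hBudget : Summit.QuantumFields.YangMills.Cruxes.UniformColdStartMixing.ColdEntropy.__Registered.stub_coldEntropyBudget) :
    Summit.QuantumFields.YangMills.Theses.ColdStartUniversality.UniformColdStartMixing :=
  UniformColdStartMixing_of_uniformLogSobolev_of_budget (uniformLogSobolev_iff_uniformEntropyDecay.2 hUED) hBudget

end Summit.QuantumFields.YangMills.Theorems.ColdStartUniversality

end
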